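import Literature.NumberTheory.Transcendental.ExpDominantSolvabilityProofs
import HarnessLib

/-!
# Brownawell–Masser with an exponentially small moving perturbation (analytic core)

The analytic core `Literature.NumberTheory.Transcendental.ExpDominant.exists_expPoint_near` of the
tree's proof of Brownawell–Masser 2017 Prop. 2 (Masser's Newton argument as in
D'Aquino–Fornasiero–Terzo 2018 §2), re-run with an additional holomorphic perturbation `G` of the
target: one solves `e^{xⱼ} = yⱼ(x) + Gⱼ(x)` instead of `e^{xⱼ} = yⱼ(x)`, for `‖G‖ e^{M}` small.
This is the "missing lemma L1" of the EC₃,₂ rung census (puncture fibres of Brownawell–Masser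
type).
-/

noncomputable section

open Complex MvPolynomial Metric Set Filter Topology
open Literature.NumberTheory.Transcendental Literature.NumberTheory.Transcendental.ExpDominant
open Literature.NumberTheory.Transcendental.HypersurfaceCover (spec)

set_option linter.dupNamespace false

namespace Summit.Schanuel.Schanuel.Theorems

variable {n : ℕ}

/-- **Perturbed analytic core** (cf. `ExpDominant.exists_expPoint_near`, D'Aquino–Fornasiero–Terzo
2018, proof of Thm 2.7): with the hypersurface model `(F, N, c, p)` of `W = Z(P)`, a lattice point
`tv` (`e^{tvⱼ} = 1`), a ball `B(tv, R)` as there (`r = M + π + 2 < R`,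
`8 M r / (R - r) ≤ 1/(32(n+1))`), and in addition holomorphic `Gⱼ` on `B(tv, R)` with
`‖Gⱼ‖ ≤ η`, `η e^{M} ≤ 1/(64(n+1))`, there is `x ∈ B(tv, R)` with
`(x, (e^{xⱼ} - Gⱼ(x))ⱼ) ∈ Z(P)`. Proof: as in the unperturbed case the coordinate functions
`yⱼ(x)` of a holomorphic sheet of `W` over the ball vary slowly, `|yⱼ(tv)| ≥ e^{-M}`, and the
fixed-point lemma `ExpDominant.exists_exp_eq_one_add` is applied to
`g̃ⱼ(ξ) = (yⱼ + Gⱼ)(tv + a + ξ)/yⱼ(tv) - 1`. [cite: DaquinoFornasieroTerzo2017, Thm 2.7 and Cor. 2.9 (proofs)] -/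
theorem exists_expPoint_near_add (P : Ideal (MvPolynomial (Fin n ⊕ Fin n) ℂ))
    {F : Polynomial (MvPolynomial (Fin n) ℂ)} (hFm : F.Monic) (hFdeg : 0 < F.natDegree)
    (N : Fin n → Polynomial (MvPolynomial (Fin n) ℂ)) (g c : MvPolynomial (Fin n) ℂ)
    (p : Fin n → Polynomial (MvPolynomial (Fin n) ℂ))
    (hcg : ∀ z, eval z g ≠ 0 → eval z c ≠ 0)
    (hmem : ∀ (z : Fin n → ℂ) (t : ℂ), eval z g ≠ 0 → (spec F z).eval t = 0 →
      (Sum.elim z (fun j => (spec (N j) z).eval t / eval z c) : Fin n ⊕ Fin n → ℂ) ∈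
        zeroLocus ℂ P)
    (hprel : ∀ j, ∀ w ∈ zeroLocus ℂ P,
      (spec (p j) (fun i => w (Sum.inl i))).eval (w (Sum.inr j)) = 0)
    (tv : Fin n → ℂ) (htv : ∀ j, Complex.exp (tv j) = 1) {R M : ℝ} (hM : 0 < M)
    (hsep : ∀ z ∈ closedBall tv R, (spec F z).Separable)
    (hg : ∀ z ∈ closedBall tv R, eval z g ≠ 0)
    (hroots : ∀ z ∈ ball tv R, ∀ j, ∀ y : ℂ, (spec (p j) z).IsRoot y →
      y ≠ 0 ∧ |Real.log ‖y‖| ≤ M)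
    (hRr : M + Real.pi + 2 < R)
    (hsmall : 8 * M * (M + Real.pi + 2) / (R - (M + Real.pi + 2)) ≤ 1 / (32 * (n + 1)))
    (G : Fin n → (Fin n → ℂ) → ℂ) (hGd : ∀ j, DifferentiableOn ℂ (G j) (ball tv R))
    {η : ℝ} (hGb : ∀ j, ∀ z ∈ ball tv R, ‖G j z‖ ≤ η)
    (hη : η * Real.exp M ≤ 1 / (64 * (n + 1))) :
    ∃ x : Fin n → ℂ, x ∈ ball tv R ∧
      (Sum.elim x (fun j => Complex.exp (x j) - G j x) : Fin n ⊕ Fin n → ℂ) ∈ zeroLocus ℂ P := by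
  set r := M + Real.pi + 2 with hr_def
  have hr : 0 < r := by have := Real.pi_pos; rw [hr_def]; linarith
  have hc : ∀ z ∈ closedBall tv R, eval z c ≠ 0 := fun z hz => hcg z (hg z hz)
  have hR : 0 < R := hr.trans hRr
  have hRr0 : 0 < R - r := by linarith
  have hn1 : (0 : ℝ) < n + 1 := by positivity
  have hε1 : (1 : ℝ) / (32 * (n + 1)) ≤ 1 := by
    rw [div_le_one (by positivity)]
    have : (0 : ℝ) ≤ n := Nat.cast_nonneg n
    linarith
  -- a holomorphic root of `F(z, ·)` over the ball
  obtain ⟨τ, hτd, hτF⟩ := exists_rootSection hFm hFdeg hR hsep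
  -- the coordinate functions `yⱼ(z) = Nⱼ(z, τ(z)) / c(z)`
  set y : Fin n → (Fin n → ℂ) → ℂ := fun j z => (spec (N j) z).eval (τ z) / eval z c with hy
  have hydiff : ∀ j, DifferentiableOn ℂ (y j) (ball tv R) := by
    intro j
    have heq : y j = fun z => (spec (N j) z).eval (τ z) * (eval z c)⁻¹ := by
      funext z; simp only [hy, div_eq_mul_inv]
    rw [heq]
    intro z hz
    have hτz : DifferentiableAt ℂ τ z := (hτd z hz).differentiableAt (isOpen_ball.mem_nhds hz)
    have h1 : DifferentiableAt ℂ (fun z => (spec (N j) z).eval (τ z)) z := by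
      have heq' : (fun z => (spec (N j) z).eval (τ z)) = fun z =>
          ∑ i ∈ Finset.range ((N j).natDegree + 1), eval z ((N j).coeff i) * τ z ^ i :=
        funext fun z => HypersurfaceCover.eval_spec_eq_sum (N j) z (τ z)
      rw [heq']
      refine DifferentiableAt.fun_sum fun i _ => ?_
      exact (DifferentiableAt.mvPolynomial_eval _ fun k =>
        (differentiableAt_pi.1 differentiableAt_id k)).mul (hτz.pow i)
    have h2 : DifferentiableAt ℂ (fun z => eval z c) z :=
      DifferentiableAt.mvPolynomial_eval _ fun k => (differentiableAt_pi.1 differentiableAt_id k)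
    have h3 : DifferentiableAt ℂ (fun z => (spec (N j) z).eval (τ z) * (eval z c)⁻¹) z :=
      h1.fun_mul (h2.fun_inv (hc z (ball_subset_closedBall hz)))
    exact h3.differentiableWithinAt
  -- points of `W`
  set wpt : (Fin n → ℂ) → (Fin n ⊕ Fin n → ℂ) := fun z => Sum.elim z (fun j => y j z) with hwpt
  have hwW : ∀ z ∈ ball tv R, wpt z ∈ zeroLocus ℂ P := fun z hz =>
    hmem z (τ z) (hg z (ball_subset_closedBall hz)) (hτF z hz)
  have hyroot : ∀ z ∈ ball tv R, ∀ j, (spec (p j) z).IsRoot (y j z) := fun z hz j => by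
    have := hprel j (wpt z) (hwW z hz)
    simpa [hwpt] using this
  have hy0 : ∀ j, ∀ z ∈ ball tv R, y j z ≠ 0 := fun j z hz =>
    (hroots z hz j _ (hyroot z hz j)).1
  have hylog : ∀ j, ∀ z ∈ ball tv R, |Real.log ‖y j z‖| ≤ M := fun j z hz =>
    (hroots z hz j _ (hyroot z hz j)).2
  have htv_mem : tv ∈ ball tv R := mem_ball_self hR
  -- lower bound `‖yⱼ(tv)‖ ≥ e^{-M}`
  have hylow : ∀ j, Real.exp (-M) ≤ ‖y j tv‖ := by
    intro j
    have h1 : -M ≤ Real.log ‖y j tv‖ := (abs_le.mp (hylog j tv htv_mem)).1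
    have h2 : 0 < ‖y j tv‖ := norm_pos_iff.mpr (hy0 j tv htv_mem)
    calc Real.exp (-M) ≤ Real.exp (Real.log ‖y j tv‖) := Real.exp_le_exp.mpr h1
      _ = ‖y j tv‖ := Real.exp_log h2
  -- the shift `aⱼ = log yⱼ(tv)`
  set a : Fin n → ℂ := fun j => Complex.log (y j tv) with ha
  have ha_norm : ‖a‖ ≤ M + Real.pi := by
    rw [pi_norm_le_iff_of_nonneg (by positivity)]
    intro j
    calc ‖a j‖ ≤ |(a j).re| + |(a j).im| := Complex.norm_le_abs_re_add_abs_im _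
      _ ≤ M + Real.pi := by
          refine add_le_add ?_ ?_
          · simp only [ha, Complex.log_re]
            exact hylog j tv htv_mem
          · simp only [ha, Complex.log_im]
            exact Complex.abs_arg_le_pi _
  -- slow variation on the small ball
  have hratio : ∀ j, ∀ x ∈ closedBall tv r, ‖y j x / y j tv - 1‖ ≤ 8 * M * r / (R - r) := by
    intro j x hx
    refine norm_div_sub_one_le hr hRr hM (hydiff j) (hy0 j) (hylog j) ?_ hx
    have h1 : 8 * M * r / (R - r) ≤ 1 := hsmall.trans hε1
    have h2 : 4 * M * r / (R - r) ≤ 8 * M * r / (R - r) := by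
      apply div_le_div_of_nonneg_right _ hRr0.le
      nlinarith [hM.le, hr.le]
    linarith
  -- the functions `g̃ⱼ(ξ) = (yⱼ + Gⱼ)(tv + a + ξ)/yⱼ(tv) - 1` on the unit polydisc
  set gt : Fin n → (Fin n → ℂ) → ℂ := fun j ξ =>
    (y j (tv + a + ξ) + G j (tv + a + ξ)) / y j tv - 1 with hgt
  have hshift : ∀ ξ ∈ ball (0 : Fin n → ℂ) 1, tv + a + ξ ∈ closedBall tv r := by
    intro ξ hξ
    rw [mem_ball, dist_zero_right] at hξ
    rw [mem_closedBall, dist_eq_norm, show tv + a + ξ - tv = a + ξ by abel]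
    calc ‖a + ξ‖ ≤ ‖a‖ + ‖ξ‖ := norm_add_le _ _
      _ ≤ M + Real.pi + 1 := by linarith [hξ.le]
      _ ≤ r := by rw [hr_def]; linarith
  have hshift' : ∀ ξ ∈ ball (0 : Fin n → ℂ) 1, tv + a + ξ ∈ ball tv R := fun ξ hξ =>
    (closedBall_subset_ball hRr) (hshift ξ hξ)
  have hgt_diff : ∀ j, DifferentiableOn ℂ (gt j) (ball 0 1) := by
    intro j
    have heq : gt j = fun ξ => (y j (tv + a + ξ) + G j (tv + a + ξ)) * (y j tv)⁻¹ - 1 := by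
      funext ξ; simp only [hgt, div_eq_mul_inv]
    rw [heq]
    intro ξ hξ
    have h1 : DifferentiableAt ℂ (fun ξ : Fin n → ℂ => tv + a + ξ) ξ :=
      differentiableAt_id.const_add _
    have h2 : DifferentiableAt ℂ (y j) (tv + a + ξ) :=
      (hydiff j).differentiableAt (isOpen_ball.mem_nhds (hshift' ξ hξ))
    have h2' : DifferentiableAt ℂ (G j) (tv + a + ξ) :=
      (hGd j).differentiableAt (isOpen_ball.mem_nhds (hshift' ξ hξ))
    have h3 : DifferentiableAt ℂ (fun ξ : Fin n → ℂ => y j (tv + a + ξ) + G j (tv + a + ξ)) ξ :=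
      (h2.comp ξ h1).add (h2'.comp ξ h1)
    have h4 : DifferentiableAt ℂ
        (fun ξ : Fin n → ℂ => (y j (tv + a + ξ) + G j (tv + a + ξ)) * (y j tv)⁻¹ - 1) ξ :=
      (h3.mul_const _).sub_const 1
    exact h4.differentiableWithinAt
  have hgt_bound : ∀ j, ∀ ξ ∈ ball (0 : Fin n → ℂ) 1, ‖gt j ξ‖ ≤ 1 / (16 * (n + 1)) := by
    intro j ξ hξ
    have hx := hshift ξ hξ
    have hx' := hshift' ξ hξ
    have hsplit : gt j ξ = (y j (tv + a + ξ) / y j tv - 1) + G j (tv + a + ξ) / y j tv := by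
      simp only [hgt]; ring
    rw [hsplit]
    have h1 : ‖y j (tv + a + ξ) / y j tv - 1‖ ≤ 1 / (32 * (n + 1)) :=
      (hratio j _ hx).trans hsmall
    have h2 : ‖G j (tv + a + ξ) / y j tv‖ ≤ 1 / (64 * (n + 1)) := by
      rw [norm_div]
      have hypos : 0 < ‖y j tv‖ := norm_pos_iff.mpr (hy0 j tv htv_mem)
      rw [div_le_iff₀ hypos]
      calc ‖G j (tv + a + ξ)‖ ≤ η := hGb j _ hx'
        _ = η * Real.exp M * Real.exp (-M) := by
            rw [mul_assoc, ← Real.exp_add, add_neg_cancel, Real.exp_zero, mul_one]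
        _ ≤ 1 / (64 * (n + 1)) * ‖y j tv‖ :=
            mul_le_mul hη (hylow j) (Real.exp_pos _).le (by positivity)
    calc ‖y j (tv + a + ξ) / y j tv - 1 + G j (tv + a + ξ) / y j tv‖
        ≤ 1 / (32 * (n + 1)) + 1 / (64 * (n + 1)) := (norm_add_le _ _).trans (add_le_add h1 h2)
      _ ≤ 1 / (16 * (n + 1)) := by
          rw [div_add_div _ _ (by positivity) (by positivity), div_le_div_iff₀ (by positivity)
            (by positivity)]
          nlinarith
  obtain ⟨ξ, hξn, hξexp⟩ := exists_exp_eq_one_add gt (ε := 1 / (16 * (n + 1))) (by positivity)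
    (le_of_eq (by field_simp)) hgt_diff hgt_bound
  -- the exponential point
  set x : Fin n → ℂ := tv + a + ξ with hx
  have hξball : ξ ∈ ball (0 : Fin n → ℂ) 1 := by
    rw [mem_ball, dist_zero_right]; linarith
  have hxball : x ∈ ball tv R := hshift' ξ hξball
  refine ⟨x, hxball, ?_⟩
  have hexp : ∀ j, Complex.exp (x j) - G j x = y j x := by
    intro j
    have h1 := hξexp j
    have hgtj : 1 + gt j ξ = (y j x + G j x) / y j tv := by simp [hgt, hx]
    have hxj : x j = tv j + a j + ξ j := by simp [hx]
    rw [hxj, Complex.exp_add, Complex.exp_add, htv j, one_mul]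
    have haj : Complex.exp (a j) = y j tv := by
      simp only [ha]
      exact Complex.exp_log (hy0 j tv htv_mem)
    rw [haj, h1, hgtj, mul_div_cancel₀ _ (hy0 j tv htv_mem), add_sub_cancel_right]
  have hpt : (Sum.elim x (fun j => Complex.exp (x j) - G j x) : Fin n ⊕ Fin n → ℂ) = wpt x := by
    funext s
    rcases s with i | j
    · rfl
    · simp [hwpt, hexp j]
  rw [hpt]
  exact hwW x hxball

end Summit.Schanuel.Schanuel.Theorems
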